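import Summits.BirchSwinnertonDyer.BirchSwinnertonDyer.Theorems.ByReductionTypeAtTwoTorsionEulerCharMultNonsplitDoor
import Summits.BirchSwinnertonDyer.BirchSwinnertonDyer.Theorems.ByReductionTypeAtTwoMultUpperHalfTower
import Summits.BirchSwinnertonDyer.Rank1Residual.X5.TwoAdicTargetsMultAuto
import HarnessLib

set_option linter.dupNamespace false -- `…BirchSwinnertonDyer.BirchSwinnertonDyer…` is the cell's nested layout (D-0017)
set_option autoImplicit false

/-!
# Route `ByReductionTypeAtTwo`, crux `MultUpperHalfAtTwo` (stmt-BirchSwinnertonDyer-19922): the upper half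
# `ord₂ #Ш ≤ ord₂ #Ш_an` at a NON-SPLIT multiplicative `2` WITHOUT the control display `hEC` and WITHOUT `E(ℚ)[2] = 0` —
# the one-sided chain fed by the kernel theorem `TorsionEulerChar.constantCoeff_mul_sq_eq_two_nonsplit`

Cell `bsd-2adic` (run/shared/lean/pub/bsd-2adic/), seat `bsd-2adic-tower-1` GEN 31; `--supports stmt-BirchSwinnertonDyer-19922`.
THEOREMS ONLY (no definition, no named fact, no `sorry`); closes no item; nothing booked; BSD is not proved by any of this.

WHY. Every non-split upper-half door of the crux (`missingUpperBoundAt_two_nonsplit_of_towerGap_of_eulerChar`,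
`X5.O1.missingUpperBoundAt_two_nonsplit_of_mu_eq_zero(_auto)`, `…_of_prop514`, …) carries the binder
`hEC : X5.O1.TwoAdicEulerCharRankZeroNonsplitMult W 0` — Greenberg's analogue of Thm. 4.1 at a non-split `2`,
`f_E(0)·#E(ℚ)(2)² = u·2^{ord₂ ∏c + 1}·#Sel`, `u ∈ ℤ₂ˣ` — kernel so far only on {`E(ℚ)[2] = 0`} (GEN 30
`MultTowerNS2LayerZero.twoAdicEulerCharRankZeroNonsplitMult_of_noTwoTorsion`) and otherwise PRINT-sourced (`h41ns'`). The
doors use only the direction `ord₂ f_E(0) + 2·ord₂ #E(ℚ)(2) ≥ ord₂ ∏c + 1 + ord₂ #Sel` («`ord₂ h(0) ≥ 0` gives (a)» in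
`X5.O1.chainUpperAtTwoNonsplit_of_divisibilityRat`), which part 6 proves for EVERY non-split multiplicative-at-`2` curve,
rational `2`-torsion allowed (`TorsionEulerChar.constantCoeff_mul_sq_eq_two_nonsplit`, `e ∈ ℤ₂ ∖ {0}` in place of `u`). This
file re-runs the b2b-bsdres chain with `e`:

* `chainUpperAtTwoNonsplit_le` — G11a-mult (a) with `e ≠ 0`: `ord₂ #Ш + ord₂ ∏c − 2·ord₂ #E(ℚ)_tors + ord₂ ϖ ≤ ord₂ t + ord₂ ϖ′`;
* `upperBound_two_nonsplit_le` — Miller's currency: `∃ q, #Ш_an = q ∧ ord₂ #Ш ≤ ord₂ q + k`;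
* `missingUpperBoundAt_two_nonsplit_of_mu_eq_zero` — road (i) per member (K11a + `μ = 0` + `0 ≤ ord₂ ϖ`), NO `hEC`;
* **`missingUpperBoundAt_two_nonsplit_of_towerGap`** — the TOWER road per member from a tower-gap certificate, NO `hEC`;
* **`missingUpperBoundAt_two_nonsplit_of_prop514`** — Greenberg Prop. 5.14 locus (a rational `2`-torsion point ramified at
  `2` XOR odd): `μ = 0` is PRINT there, so the door needs only K11a + modularity + GZK + `0 ≤ ord₂ ϖ` — NO `hEC`, for curves
  WITH rational `2`-torsion (exactly where GEN 30's kernel `hEC` did not reach). Class doors: sequel.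

HONEST FRAMING: assembly over tree theorems; the remaining displayed inputs are unchanged MEMO/PRINT binders (Kato `⊗ℚ` at a
multiplicative `2` = K11a, modularity, GZK, Prop. 5.14, the period datum); closes no item; no summit statement is proved; the
Birch–Swinnerton-Dyer conjecture is NOT proved by any of this.

References: [GreenbergLNM1716] Thm. 4.1, §4 pp. 112–113, Prop. 5.14 (p. 121); [MazurTateTeitelbaum1986Invent] §I.10, §I.14;
[Kato2004Asterisque] Thm. 17.4; [Miller2011LMS] Def. 1.1; [Washington1997] §13.2.
-/

noncomputable section

open scoped Classical MatrixGroups ModularForm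

open NumberField IsDedekindDomain CongruenceSubgroup WeierstrassCurve Literature.NumberTheory.EllipticCurves
  Literature.NumberTheory.EllipticCurves.ModularForms
  Literature.NumberTheory.EllipticCurves.Greenberg1999
  Literature.NumberTheory.EllipticCurves.Wuthrich2014
  Literature.NumberTheory.EllipticCurves.Rank1Residual
  Literature.NumberTheory.EllipticCurves.Rank1Residual.Typed
  Summit.BirchSwinnertonDyer.Rank1Residual.X5 Summit.BirchSwinnertonDyer.Rank1Residual.X5.O1

namespace Summit.BirchSwinnertonDyer.BirchSwinnertonDyer.Theorems.TorsionEulerChar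

section PerMember

variable (W : WeierstrassCurve ℚ) [W.IsElliptic] [W.IsGloballyMinimal]

/-! ## §1 G11a-mult (a) with `e ≠ 0` -/

/-- **G11a-mult (a) at a NON-SPLIT multiplicative `2` from ONE divisibility datum, NO `hEC`, NO hypothesis on `E(ℚ)[2]`.**
For `W/ℚ` globally minimal, non-split multiplicative at `2`, `L(E,1) ≠ 0`, `Ш(E/ℚ)` finite, a cyclotomic datum, a newform
`f` of `E`, a `2`-adic `L`-function `L` of `f` with `α = −1`, a dual datum `D`, the period ratio `ϖ`, a non-zero `ϖ′` and the
datum «`X` torsion and `ι g = ϖ′ · L` for some `g ∈ char_Λ X`»: `L(E,1)/Ω_E = t ∈ ℚ` with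
`ord₂ #Ш + ord₂ ∏c_ℓ − 2·ord₂ #E(ℚ)_tors + ord₂ ϖ ≤ ord₂ t + ord₂ ϖ′`. The proof is
`X5.O1.chainUpperAtTwoNonsplit_of_divisibilityRat` (a) verbatim with Greenberg's display replaced by the kernel theorem
`constantCoeff_mul_sq_eq_two_nonsplit` (`e ∈ ℤ₂ ∖ {0}`; `ord₂ e ≥ 0` only sharpens (a)).
[cite: GreenbergLNM1716, Thm. 4.1 and §4 pp. 112–113] [cite: MazurTateTeitelbaum1986Invent, §I.10 and §I.14 (14.3)] -/
theorem chainUpperAtTwoNonsplit_le (hmult : Mult W 2) (hns : ¬ W.HasSplitMultiplicativeReductionAtPrime 2)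
    (hL : W.entireLFunction 1 ≠ 0) (hfin : Finite W.sha)
    {κ : ZpExtension ℚ 2} {γ : Field.absoluteGaloisGroup ℚ} {N : ℕ} [NeZero N]
    {f : CuspForm (Gamma0 N) 2} (hκ : κ.IsCyclotomic) (hγ : κ.IsTopGenerator γ)
    (hf : IsNewformOf W f) {L : PowerSeries ℚ_[2]}
    (hLf : IsMultPAdicLFunctionOf f 2 (-1) L) (D : W.SelmerDualData κ γ) (ϖ : ℚ)
    (hϖ : (ϖ : ℝ) * W.realPeriodRat = plusPeriod f) {ϖ' : ℚ} (hϖ'0 : ϖ' ≠ 0)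
    (hdiv : D.IsTorsion ∧ ∃ g ∈ D.charIdeal, iwasawaToPowerSeries 2 g =
        PowerSeries.C (ϖ' : ℚ_[2]) * L) :
    ∃ t : ℚ, W.entireLFunction 1 / (W.realPeriodRat : ℂ) = (t : ℂ) ∧
      (padicValNat 2 W.shaOrder : ℤ) + padicValNat 2 W.tamagawaProduct -
          2 * padicValNat 2 W.torsionOrder + padicValRat 2 ϖ ≤ padicValRat 2 t + padicValRat 2 ϖ' := by
  -- adapted from `X5.O1.chainUpperAtTwoNonsplit_of_divisibilityRat` (cell b2b-bsdres), Steps 0–8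
  -- Step 0: `t = ϖ · [0]⁺_f = L(E,1)/Ω_E`
  have hΩpos : 0 < W.realPeriodRat := W.realPeriodRat_pos_holds
  have hϖ0 : ϖ ≠ 0 := by
    rintro rfl
    have hper : 0 < plusPeriod f := IsNewform0.plusPeriod_pos_holds hf.1 hf.coeffField_eq_bot
    rw [← hϖ, Rat.cast_zero, zero_mul] at hper
    exact lt_irrefl _ hper
  set s : ℚ := ratPlusSymbol f 0 with hs_def
  set t : ℚ := ϖ * s with ht_def
  have hLval : W.entireLFunction 1 = (((s : ℝ) * plusPeriod f : ℝ) : ℂ) := hf.entireLFunction_one_eq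
  have hq : W.entireLFunction 1 / (W.realPeriodRat : ℂ) = ((t : ℚ) : ℂ) := by
    rw [hLval, ← hϖ, div_eq_iff (Complex.ofReal_ne_zero.mpr hΩpos.ne'), ht_def]
    push_cast
    ring
  have hs0 : s ≠ 0 := by
    intro h0
    apply hL
    rw [hLval, h0]
    simp
  have hvt : padicValRat 2 t = padicValRat 2 ϖ + padicValRat 2 s := by
    rw [ht_def, padicValRat.mul hϖ0 hs0]
  -- Step 1–2: the Iwasawa module, a generator `fE` of `char_Λ X`, the cofactor `h`
  haveI : Module.Finite (IwasawaAlgebra 2) D.X := D.module_finite_holds hγ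
  obtain ⟨hX, g, hgmem, hιg⟩ := hdiv
  haveI : (Module.charIdeal (IwasawaAlgebra 2) D.X).IsPrincipal := charIdeal_isPrincipal_holds 2 D.X
  obtain ⟨fE, hchar⟩ := Submodule.IsPrincipal.principal (Module.charIdeal (IwasawaAlgebra 2) D.X)
  have hchar' : D.charIdeal = Ideal.span {fE} := hchar
  have hgmem' : g ∈ Ideal.span {fE} := by rw [← hchar']; exact hgmem
  obtain ⟨h, hgh⟩ := Ideal.mem_span_singleton'.mp hgmem'
  -- Step 3: interpolation `g(0) = ϖ′ · 2 · [0]⁺_f`, and `g(0) = h(0) · fE(0)`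
  have hg0 : ((PowerSeries.constantCoeff g : ℤ_[2]) : ℚ_[2]) =
      (ϖ' : ℚ_[2]) * (2 * (s : ℚ_[2])) := by
    rw [← constantCoeff_iwasawaToPowerSeries 2 g, hιg, map_mul, PowerSeries.constantCoeff_C,
      hLf.constantCoeff_of_neg_one]
  have hg0' : (PowerSeries.constantCoeff g : ℤ_[2]) =
      PowerSeries.constantCoeff h * PowerSeries.constantCoeff fE := by
    rw [← hgh, map_mul]
  have hsQ0 : (s : ℚ_[2]) ≠ 0 := by exact_mod_cast hs0
  have hϖ'Q0 : (ϖ' : ℚ_[2]) ≠ 0 := by exact_mod_cast hϖ'0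
  have h20 : (2 : ℚ_[2]) ≠ 0 := two_ne_zero
  -- Step 4: `g(0) ≠ 0` ⟹ `fE(0) ≠ 0`, `h(0) ≠ 0`, `Sel_{2^∞}(E/ℚ)` finite
  have hg00 : PowerSeries.constantCoeff g ≠ 0 := by
    intro h0
    rw [h0, PadicInt.coe_zero] at hg0
    exact (mul_ne_zero hϖ'Q0 (mul_ne_zero h20 hsQ0)) hg0.symm
  have hfE00 : PowerSeries.constantCoeff fE ≠ 0 := by
    intro h0
    apply hg00
    rw [hg0', h0, mul_zero]
  have hh00 : PowerSeries.constantCoeff h ≠ 0 := by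
    intro h0
    apply hg00
    rw [hg0', h0, zero_mul]
  have hSelfin : Finite (W.selmerGroupPInfty 2) :=
    D.finite_selmerGroupPInfty_of_constantCoeff_ne_zero W hγ hX fE hchar' hfE00
  obtain ⟨hEfin, hShapfin⟩ := (W.finite_selmerGroupPInfty_iff 2).mp hSelfin
  haveI := hEfin
  haveI := hShapfin
  haveI := hSelfin
  haveI : Finite W.sha := hfin
  -- Step 5: THE KERNEL UPPER-HALF DISPLAY (part 6), `e ∈ ℤ₂ ∖ {0}`
  obtain ⟨-, -, e, he, hu₁⟩ := constantCoeff_mul_sq_eq_two_nonsplit W hmult hns κ hκ hγ D fE hchar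
  -- Step 6: the remaining bridges
  haveI : NeZero (2 : ℕ) := ⟨two_ne_zero⟩
  obtain ⟨u₄, hu₄⟩ := exists_unit_torsionOrder_eq W 2
  obtain ⟨u₅, hu₅⟩ := exists_unit_natCard_eq_mul_card_primaryComponent W.sha 2
  have hSel : Nat.card (W.selmerGroupPInfty 2) = Nat.card (AddCommGroup.primaryComponent W.sha 2) :=
    W.natCard_selmerGroupPInfty_eq_natCard_primaryComponent_sha 2
  set v := padicValNat 2 W.tamagawaProduct with hv
  set Tp : ℚ_[2] := (Nat.card (AddCommGroup.primaryComponent W.toAffine.Point 2) : ℚ_[2]) with hTp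
  set Shp : ℚ_[2] := (Nat.card (AddCommGroup.primaryComponent W.sha 2) : ℚ_[2]) with hShp
  set h0 : ℚ_[2] := ((PowerSeries.constantCoeff h : ℤ_[2]) : ℚ_[2]) with hh0
  set e0 : ℚ_[2] := ((e : ℤ_[2]) : ℚ_[2]) with he0
  have hh0ne : h0 ≠ 0 := by
    rw [hh0]
    intro h0'
    exact hh00 (by exact_mod_cast (PadicInt.coe_eq_zero.mp h0'))
  have hh0val : 0 ≤ h0.valuation := by
    rw [hh0]
    exact PadicInt.valuation_coe_nonneg
  have he0ne : e0 ≠ 0 := by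
    rw [he0]
    intro h0'
    exact he (PadicInt.coe_eq_zero.mp h0')
  have he0val : 0 ≤ e0.valuation := by
    rw [he0]
    exact PadicInt.valuation_coe_nonneg
  -- the display in `ℚ_2`: `fE(0) · Tp² = e0 · 2^(v+1) · #Sel`
  have hu₁Q : ((PowerSeries.constantCoeff fE : ℤ_[2]) : ℚ_[2]) * Tp ^ 2 =
      e0 * (2 : ℚ_[2]) ^ (v + 1) * (Nat.card (W.selmerGroupPInfty 2) : ℚ_[2]) := by
    have h := congrArg ((↑) : ℤ_[2] → ℚ_[2]) hu₁
    push_cast at h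
    rw [hTp, he0, hv]
    exact h
  -- `#E(ℚ)_tors = u₄ · Tp`, `#Ш = u₅ · Shp`, `#Sel = Shp`
  have hu₄' : (W.torsionOrder : ℚ_[2]) = ((u₄ : ℤ_[2]) : ℚ_[2]) * Tp := by
    rw [hu₄, hTp]
    congr 1
    exact_mod_cast natCard_primaryComponent_point_congr W 2 _ _
  have hSha : (W.shaOrder : ℚ_[2]) = ((u₅ : ℤ_[2]) : ℚ_[2]) * Shp := by
    rw [WeierstrassCurve.shaOrder, hShp]
    exact hu₅
  have hSel' : (Nat.card (W.selmerGroupPInfty 2) : ℚ_[2]) = Shp := by rw [hShp, hSel]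
  have hg0Q : ((PowerSeries.constantCoeff g : ℤ_[2]) : ℚ_[2]) =
      h0 * ((PowerSeries.constantCoeff fE : ℤ_[2]) : ℚ_[2]) := by
    rw [hg0', hh0]; push_cast; ring
  -- Step 7: `ϖ′ · 2 · s · Tp² = h0 · e0 · 2^(v+1) · Shp` in `ℚ_2`
  have key : (ϖ' : ℚ_[2]) * (2 * (s : ℚ_[2])) * Tp ^ 2 =
      h0 * (e0 * (2 : ℚ_[2]) ^ (v + 1) * Shp) := by
    calc (ϖ' : ℚ_[2]) * (2 * (s : ℚ_[2])) * Tp ^ 2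
        = h0 * (((PowerSeries.constantCoeff fE : ℤ_[2]) : ℚ_[2]) * Tp ^ 2) := by
          rw [← hg0, hg0Q]; ring
      _ = h0 * (e0 * (2 : ℚ_[2]) ^ (v + 1) * (Nat.card (W.selmerGroupPInfty 2) : ℚ_[2])) := by rw [hu₁Q]
      _ = h0 * (e0 * (2 : ℚ_[2]) ^ (v + 1) * Shp) := by rw [hSel']
  -- Step 8: valuations
  have hTp0 : Tp ≠ 0 := by rw [hTp]; exact_mod_cast Nat.card_pos.ne'
  have hShp0 : Shp ≠ 0 := by rw [hShp]; exact_mod_cast Nat.card_pos.ne'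
  have hv2 : (2 : ℚ_[2]).valuation = 1 := by
    have h2 : ((2 : ℕ) : ℚ_[2]).valuation = 1 := Padic.valuation_p
    rwa [Nat.cast_ofNat] at h2
  have hvalL : ((ϖ' : ℚ_[2]) * (2 * (s : ℚ_[2])) * Tp ^ 2).valuation =
      padicValRat 2 ϖ' + (1 + padicValRat 2 s) + 2 * Tp.valuation := by
    rw [Padic.valuation_mul (mul_ne_zero hϖ'Q0 (mul_ne_zero h20 hsQ0)) (pow_ne_zero 2 hTp0),
      Padic.valuation_mul hϖ'Q0 (mul_ne_zero h20 hsQ0), Padic.valuation_mul h20 hsQ0,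
      Padic.valuation_pow Tp, hv2, Padic.valuation_ratCast, Padic.valuation_ratCast]
    push_cast
    ring
  have hvalR : (h0 * (e0 * (2 : ℚ_[2]) ^ (v + 1) * Shp)).valuation =
      h0.valuation + (e0.valuation + ((v : ℤ) + 1) + Shp.valuation) := by
    rw [Padic.valuation_mul hh0ne (mul_ne_zero (mul_ne_zero he0ne (pow_ne_zero _ h20)) hShp0),
      Padic.valuation_mul (mul_ne_zero he0ne (pow_ne_zero _ h20)) hShp0,
      Padic.valuation_mul he0ne (pow_ne_zero _ h20), Padic.valuation_pow, hv2]
    push_cast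
    ring
  have hval := congrArg Padic.valuation key
  rw [hvalL, hvalR] at hval
  have hvT : Tp.valuation = (padicValNat 2 W.torsionOrder : ℤ) := by
    have h := congrArg Padic.valuation hu₄'
    rw [Padic.valuation_natCast, Padic.valuation_mul (coe_units_ne_zero 2 u₄) hTp0,
      valuation_coe_units_eq_zero, zero_add] at h
    exact h.symm
  have hvS : Shp.valuation = (padicValNat 2 W.shaOrder : ℤ) := by
    have h := congrArg Padic.valuation hSha
    rw [Padic.valuation_natCast, Padic.valuation_mul (coe_units_ne_zero 2 u₅) hShp0,
      valuation_coe_units_eq_zero, zero_add] at h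
    exact h.symm
  rw [hvT, hvS] at hval
  exact ⟨t, hq, by linarith⟩

/-! ## §2 Miller's currency -/

/-- **G11a-mult (a) in Miller's currency at a NON-SPLIT multiplicative `2`, NO `hEC`** (`ι g = ϖ′ · L`, `g ∈ char_Λ X`,
`X` torsion, `ord₂ ϖ′ ≤ ord₂ ϖ + k`): `L(E,1) ≠ 0`, GZK (`#Ш_an = t · #E(ℚ)² / ∏c_ℓ`) ⇒
`∃ q, #Ш_an = q ∧ ord₂ #Ш ≤ ord₂ q + k`. Twin of `X5.O1.upperBound_two_nonsplit_of_divisibilityRat` on §1.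
[cite: Miller2011LMS, Def. 1.1 and §1] [cite: GreenbergLNM1716, §4 pp. 112–113] -/
theorem upperBound_two_nonsplit_le (hGZK : rank_eq_analyticRank_of_analyticRank_le_one)
    (hmult : Mult W 2) (hns : ¬ W.HasSplitMultiplicativeReductionAtPrime 2)
    (hL : W.entireLFunction 1 ≠ 0)
    {κ : ZpExtension ℚ 2} {γ : Field.absoluteGaloisGroup ℚ} {N : ℕ} [NeZero N]
    {f : CuspForm (Gamma0 N) 2} (hκ : κ.IsCyclotomic) (hγ : κ.IsTopGenerator γ)
    (hf : IsNewformOf W f) {L : PowerSeries ℚ_[2]}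
    (hLf : IsMultPAdicLFunctionOf f 2 (-1) L) (D : W.SelmerDualData κ γ) (ϖ : ℚ)
    (hϖ : (ϖ : ℝ) * W.realPeriodRat = plusPeriod f) {ϖ' : ℚ} (hϖ'0 : ϖ' ≠ 0) (k : ℕ)
    (hk : padicValRat 2 ϖ' ≤ padicValRat 2 ϖ + k)
    (hdiv : D.IsTorsion ∧ ∃ g ∈ D.charIdeal, iwasawaToPowerSeries 2 g =
        PowerSeries.C (ϖ' : ℚ_[2]) * L) :
    ∃ q : ℚ, shaAn W = (q : ℂ) ∧ (padicValNat 2 W.shaOrder : ℤ) ≤ padicValRat 2 q + k := by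
  -- adapted from `X5.O1.upperBound_two_nonsplit_of_divisibilityRat` (cell b2b-bsdres)
  have hr : W.analyticRank = 0 := analyticRank_eq_zero_of_entireLFunction_one_ne_zero W hL
  obtain ⟨-, hfin⟩ := hGZK W (by rw [hr]; exact zero_le_one)
  obtain ⟨t, ht, hle⟩ := chainUpperAtTwoNonsplit_le W hmult hns hL hfin hκ hγ hf hLf D ϖ hϖ hϖ'0 hdiv
  obtain ⟨-, hE, -, hshaAn⟩ := shaAn_eq_of_L_one_div_eq hGZK W hL ht
  haveI := hE
  have hΩ : (W.realPeriodRat : ℂ) ≠ 0 := by exact_mod_cast W.realPeriodRat_pos_holds.ne'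
  have ht0 : t ≠ 0 := by
    rintro rfl
    apply hL
    rw [Rat.cast_zero, div_eq_zero_iff] at ht
    exact ht.resolve_right hΩ
  have hcard : (Nat.card W.toAffine.Point : ℚ) ≠ 0 := by
    exact_mod_cast (Nat.card_pos (α := W.toAffine.Point)).ne'
  have htam : (W.tamagawaProduct : ℚ) ≠ 0 := by
    exact_mod_cast (W.tamagawaProduct_pos_holds : 0 < W.tamagawaProduct).ne'
  have hcardT : (Nat.card W.toAffine.Point : ℚ) = (W.torsionOrder : ℚ) := by
    exact_mod_cast (W.torsionOrder_eq_natCard_of_finite).symm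
  refine ⟨t * (Nat.card W.toAffine.Point : ℚ) ^ 2 / (W.tamagawaProduct : ℚ), hshaAn, ?_⟩
  rw [padicValRat.div (mul_ne_zero ht0 (pow_ne_zero 2 hcard)) htam,
    padicValRat.mul ht0 (pow_ne_zero 2 hcard), padicValRat.pow, hcardT]
  simp only [padicValRat.of_nat, Nat.cast_ofNat]
  linarith

/-! ## §3 The doors without `hEC` -/

/-- **ROAD (i) per member at a NON-SPLIT multiplicative `2`, NO `hEC`, NO `E(ℚ)[2] = 0`:** analytic rank `0`, modularity,
GZK, K11a for the newform at level `N_E` (`hK`), `μ = 0` for the cyclotomic data (`hμ`), and the period datum `0 ≤ ord₂ ϖ`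
(`hper₀`; the Néron integrality certificate is then automatic, `exists_iwasawaToPowerSeries_eq_C_mul_of_isMultPAdicLFunctionOf_neg_one_two`)
⟹ `MissingUpperBoundAt W 2`. Twin of `X5.O1.missingUpperBoundAt_two_nonsplit_of_mu_eq_zero_auto` with the control display
DISCHARGED by `constantCoeff_mul_sq_eq_two_nonsplit`. [cite: GreenbergLNM1716, §4 pp. 112–113]
[cite: MazurTateTeitelbaum1986Invent, §I.10 and §I.12] [cite: Miller2011LMS, Def. 1.1] -/
theorem missingUpperBoundAt_two_nonsplit_of_mu_eq_zero (hmod : nonempty_modularParametrizationData)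
    (hGZK : rank_eq_analyticRank_of_analyticRank_le_one)
    (hK : ∀ [NeZero (W.conductorNorm ℤ)] (f : CuspForm (Gamma0 (W.conductorNorm ℤ)) 2)
      (L : PowerSeries ℚ_[2]), KatoDivisibilityAtTwoNonsplitMultRat W f L)
    (hμ : ∀ (κ : ZpExtension ℚ 2) (γ : Field.absoluteGaloisGroup ℚ), κ.IsCyclotomic →
      κ.IsTopGenerator γ → IsCyclotomicVariable 2 γ → ∀ D : W.SelmerDualData κ γ, D.mu = 0)
    (hper₀ : ∀ [NeZero (W.conductorNorm ℤ)] (f : CuspForm (Gamma0 (W.conductorNorm ℤ)) 2),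
      IsNewformOf W f → ∀ ϖ : ℚ, (ϖ : ℝ) * W.realPeriodRat = plusPeriod f → 0 ≤ padicValRat 2 ϖ)
    (hr : W.analyticRank = 0) (hmult : Mult W 2)
    (hns : ¬ W.HasSplitMultiplicativeReductionAtPrime 2) : MissingUpperBoundAt W 2 := by
  -- adapted from `X5.O1.missingUpperBoundAt_two_nonsplit_of_mu_eq_zero(_auto)` (cell b2b-bsdres)
  haveI : NeZero (W.conductorNorm ℤ) := ⟨(W.conductorNorm_pos_holds).ne'⟩
  obtain ⟨Dm⟩ := hmod W
  have hf : IsNewformOf W Dm.f := Dm.isNewformOf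
  have hL : W.entireLFunction 1 ≠ 0 :=
    (W.analyticRank_eq_zero_iff_holds hf.hasEntireLFunction).mp hr
  obtain ⟨ϖ, hϖpos, hϖeq, -⟩ := Dm.exists_rat_mul_realPeriodRat_eq_plusPeriod
  obtain ⟨κ, hκ, γ, hγ, hγ'⟩ := exists_isCyclotomic_isTopGenerator_isCyclotomicVariable_holds 2
  obtain ⟨D⟩ := W.nonempty_selmerDualData_holds κ γ hγ
  obtain ⟨L, hLf⟩ := exists_isMultPAdicLFunctionOf_neg_one_of_nonsplit hf hmult hns
  obtain ⟨hX, n, g, hg, hι⟩ := hK Dm.f L κ γ hκ hγ hγ' hmult hns hf hLf D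
  obtain ⟨L₀, hL₀⟩ := exists_iwasawaToPowerSeries_eq_C_mul_of_isMultPAdicLFunctionOf_neg_one_two hf hmult hns
    (hper₀ Dm.f hf ϖ hϖeq) hLf
  have hmem : L₀ ∈ D.charIdeal :=
    charIdeal_dvd_of_divisibility_of_mu_eq_zero W 2 hγ D hX (hμ κ γ hκ hγ hγ' D) ⟨n, g, hg, hι⟩ hL₀
  obtain ⟨q, hq, hle⟩ := upperBound_two_nonsplit_le W hGZK hmult hns hL hκ hγ hf hLf D ϖ hϖeq hϖpos.ne' 0
    (by simp) ⟨hX, L₀, hmem, hL₀⟩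
  exact ⟨q, hq, by simpa using hle⟩

/-- **THE TOWER ROAD per member at a NON-SPLIT multiplicative `2`, NO `hEC`, NO `E(ℚ)[2] = 0`.** For a globally minimal elliptic
`W/ℚ` of analytic rank `0`, non-split multiplicative at `2`: Kato's divisibility `⊗ℚ` at `2` (`hKato`, MEMO K11a), modularity,
GZK, the period datum `0 ≤ ord₂ ϖ` and a tower-gap certificate `O1.TowerGapAtTwo W` (which gives `μ = 0`,
`mu_eq_zero_of_towerGapAtTwo`) ⟹ `MissingUpperBoundAt W 2`. Twin of `missingUpperBoundAt_two_nonsplit_of_towerGap_of_eulerChar`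
with `hEC` DISCHARGED — so the class doors no longer need the print binder `h41ns'` at a non-split member, whatever its
rational `2`-torsion. [cite: Washington1997, §13.2] [cite: Kato2004Asterisque, Thm. 17.4 (p. 273) and 17.13]
[cite: GreenbergLNM1716, §4 pp. 112–113] [cite: Miller2011LMS, Def. 1.1] -/
theorem missingUpperBoundAt_two_nonsplit_of_towerGap (hKato : KatoMultiplicativeDivisibilityRat W 2)
    (hmod : nonempty_modularParametrizationData)
    (hGZK : rank_eq_analyticRank_of_analyticRank_le_one)
    (hper₀ : ∀ [NeZero (W.conductorNorm ℤ)] (f : CuspForm (Gamma0 (W.conductorNorm ℤ)) 2),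
      IsNewformOf W f → ∀ ϖ : ℚ, (ϖ : ℝ) * W.realPeriodRat = plusPeriod f → 0 ≤ padicValRat 2 ϖ)
    (hgap : TowerGapAtTwo W) (hr : W.analyticRank = 0) (hmult : Mult W 2)
    (hns : ¬ W.HasSplitMultiplicativeReductionAtPrime 2) :
    MissingUpperBoundAt W 2 :=
  missingUpperBoundAt_two_nonsplit_of_mu_eq_zero W hmod hGZK
    (fun f L => katoDivisibilityAtTwoNonsplitMultRat_of_multRat W hKato f L)
    (mu_eq_zero_of_towerGapAtTwo W hgap) hper₀ hr hmult hns

/-- **GREENBERG PROP. 5.14 LOCUS at a NON-SPLIT multiplicative `2`, NO `hEC`** — the road for curves WITH a rational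
`2`-torsion point `(x, y)` ramified at `2` XOR odd (there `μ = 0 ∧ X` torsion is PRINT, `prop514_isTorsion_mu_eq_zero_two`,
multiplicative branch): rank `0`, K11a (`hK`), modularity, GZK, `0 ≤ ord₂ ϖ` ⟹ `MissingUpperBoundAt W 2`. Twin of
`X5.O1.missingUpperBoundAt_two_nonsplit_of_prop514(_auto)` with the control display DISCHARGED — precisely the members with
rational `2`-torsion that GEN 30's kernel `hEC` (`E(ℚ)[2] = 0`) could not serve.
[cite: GreenbergLNM1716, Prop. 5.14 (p. 121) and §4 pp. 112–113] [cite: Miller2011LMS, Def. 1.1] -/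
theorem missingUpperBoundAt_two_nonsplit_of_prop514 (h514 : prop514_isTorsion_mu_eq_zero_two)
    (hmod : nonempty_modularParametrizationData)
    (hGZK : rank_eq_analyticRank_of_analyticRank_le_one)
    (hK : ∀ [NeZero (W.conductorNorm ℤ)] (f : CuspForm (Gamma0 (W.conductorNorm ℤ)) 2)
      (L : PowerSeries ℚ_[2]), KatoDivisibilityAtTwoNonsplitMultRat W f L)
    (hper₀ : ∀ [NeZero (W.conductorNorm ℤ)] (f : CuspForm (Gamma0 (W.conductorNorm ℤ)) 2),
      IsNewformOf W f → ∀ ϖ : ℚ, (ϖ : ℝ) * W.realPeriodRat = plusPeriod f → 0 ≤ padicValRat 2 ϖ)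
    (hr : W.analyticRank = 0) (hmult : Mult W 2) (hns : ¬ W.HasSplitMultiplicativeReductionAtPrime 2)
    {x y : ℚ} (hP : W.toAffine.Equation x y) (h2 : 2 * y + W.a₁ * x + W.a₃ = 0)
    (hΦ : (TwoTorsionRamifiedAtTwo x ∧ ¬ TwoTorsionOdd W x) ∨
      (TwoTorsionOdd W x ∧ ¬ TwoTorsionRamifiedAtTwo x)) : MissingUpperBoundAt W 2 :=
  missingUpperBoundAt_two_nonsplit_of_mu_eq_zero W hmod hGZK hK
    (fun _ _ hκ hγ _ D => (h514.of_mult W hmult hP h2 hΦ hκ hγ D).2) hper₀ hr hmult hns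

end PerMember

end Summit.BirchSwinnertonDyer.BirchSwinnertonDyer.Theorems.TorsionEulerChar

end
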